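import Summits.BirchSwinnertonDyer.BirchSwinnertonDyer.Theorems.KolyvaginDepthDoorKolyvaginDepthSupplyDoorOfDatumPrintTwist
import Summits.BirchSwinnertonDyer.BirchSwinnertonDyer.Theorems.KolyvaginDepthDoorKolyvaginDepthSupplyDoorSecondSign
import Summits.BirchSwinnertonDyer.BirchSwinnertonDyer.Theorems.KolyvaginDepthDoorKNSupplyManinFrameStructure
import Summits.BirchSwinnertonDyer.BirchSwinnertonDyer.Theorems.KolyvaginDepthDoorKNSupplyLevelOneStructure
import Literature.NumberTheory.EllipticCurves.IrreducibleModPQuadraticTwistProofs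
import Literature.NumberTheory.EllipticCurves.NeronIsogenyScalingHoldsProofs
import HarnessLib

/-!
# Route `KolyvaginDepthDoor`, crux `KolyvaginDepthSupplyKN` (stmt-BirchSwinnertonDyer-22820) —
# THE EXACT READING OF THE CRUX BODY PER `(E, p, K)`, ALL RANKS, NO TWIST PINNING:
# «some frame, some `n₁ ∈ Λ`, some datum with `c_1(n₁) ≠ 0` AND the signed rank clause»
# `↔` «`Ш(E/ℚ)[p] = 0` ∧ TWIST CONDITION» (door: (γ) only; supply: Castella–Sano ∘ Zanarella ∘
# Howard–Zanarella on the frame with `p ∤ c_φ` from modularity + Mazur — Néron scaling DISCHARGED)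

Helper file of the lead prover of line `levelone` (kdd-p1 g14; `--supports stmt-BirchSwinnertonDyer-22820
--as helper`); it closes nothing and BSD is not proved by it.

g11/g13's rank-2 slice (`KolyvaginDepthDoorKNSupplyRankTwoSlice{,Primitive,Manin}`) reads the depth-table
bit as «`Ш(E)[p] = 0`» for a curve of Mordell–Weil rank EXACTLY `2` with the twist side PINNED
(`rank E^{(d_K)} ≤ 1`, `Ш(E^{(d_K)})[p] = 0`). This file removes both restrictions and states what the
crux's `∃`-body says at a given admissible `(E, p, K)` of the Kodaira–Néron cell, for EVERY rank and
with NO hypothesis on the twist: writing `r = rank E(ℚ)`, `r' = rank E^{(d_K)}(ℚ)`,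

  TWIST CONDITION `TC(E, p, K)` := `#Sel_p(E^{(d_K)}/ℚ) ≤ p^r` ∨ (`Ш(E^{(d_K)}/ℚ)[p] = 0` ∧ `r' = r + 1`),

* `rankClause_of_structure_of_twistCondition` — SUPPLY CONVERSION (route-free, UNCONDITIONAL): the
  mod-`p` structure statement at `(E, p, K)` in W. Zhang's Lemma 8.4 (1) shape WITH BOTH HALVES of the
  dichotomy (a minimal class `c_1(n) ≠ 0` with `#Sel_p(E) = p^{ν+1} ∧ #Sel_p(E^{(d_K)}) ≤ p^ν` or the
  mirror statement) + `Ш(E)[p] = 0` + `TC` ⟹ that class satisfies the crux's SIGNED clause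
  `ν+1 ≤ r ∨ (ν ≤ r ∧ ν+1 ≤ r')`. (g12's `levelOne_kolyvaginClass_rankClause_of_structure` is the special
  case `r' ≤ 1 ∧ Ш(E^{(d_K)})[p] = 0`.) Exact descent counts only; no parity theorem: on the `E`-side of
  the dichotomy the first clause holds outright; on the twist side `r ≤ ν`, the first disjunct of `TC`
  is then contradictory and the second gives `ν = r`, `r' = ν + 1`.
* `shaTrivial_twistCondition_of_kolyvaginClass_rankClause_kodairaNeron` — DOOR, (γ) only: a datum with
  `c_1(n₁) ≠ 0` and the signed clause gives `Ш(E)[p] = 0` and `TC` — indeed the SHARPER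
  `#Sel_p(E^{(d_K)}) ≤ p^{r−1} ∧ 1 ≤ r` in the first-sign case (g8/g9's doors
  `shaCorank_eq_zero_of_kolyvaginClass_ne_zero_of_rank_le_of_datum_kodairaNeron`,
  `natCard_selmerGroup_twist_le_of_kolyvaginClass_ne_zero_of_datum_kodairaNeron`, and the second-sign
  door `…_of_twist_rank_of_datum_kodairaNeron`).
* `kolyvaginClass_rankClause_iff_shaTrivial_twistCondition_of_maninPrint` — **THE EXACT READING**, per
  `(E, p, K)` with `p ≥ 5` good ordinary, tower onto, Kodaira–Néron, `K` Heegner, `d_K` odd, `≠ −3, −4`,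
  `p ∤ d_K`, `p` split: «∃ frame, `n₁ ∈ Λ`, datum: `c_1(n₁) ≠ 0` ∧ signed clause» `↔` «`Ш(E)[p] = 0 ∧ TC`»,
  modulo (γ) and FIVE print facts by name (Castella–Sano Thm. 3, Zanarella 2.18 (Selmer form),
  Howard–Zanarella rigidity, modularity, Mazur 1978 Cor. 4.1) — the Néron mapping property that g13's
  files took by name is the tree THEOREM `integral_neronScaling_of_isGloballyMinimal_holds` and is
  DISCHARGED here.

Reading: at a given `(E, p, K)` the KN crux body is «`Ш(E/ℚ)[p] = 0`» (KatoTransfer's X1 at the torsion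
level) PLUS a condition on the `p`-Selmer group of ONE Heegner twist; the twist supply of the line
(`r' ≤ 1`, `Ш(E^{(d_K)})` finite, `p` large) is one way of meeting `TC`, not the only one. The class-wide
consequences (skeleton v10: the open stub becomes «∃ admissible `(p, K)`: `Ш(E)[p] = 0 ∧ TC`», sandwiched
against the crux) are in `KolyvaginDepthDoorKNSupplyCompositionV10`.

CONDITIONAL on the named facts where stated; per `(E, p, K)`; BSD is NOT proved by any of this.

References: [Kolyvagin1991MathAnn] Thm. 2.3; [GrossLMS1991] Prop. 3.7 (2), §5 (5.1), §10;
[CastellaSano2026] Thm. 3 (arXiv:2601.14504 §1.1.6); [Zanarella2019] Prop. 2.18, Cor. 2.12, 2.14;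
[Howard2004] Lemma 1.6.4; [Mazur1978] Cor. 4.1; [WZhang2014] Lemma 8.4 (1) (p. 236; shape only);
[SilvermanAEC2009] Thm. X.4.2.
-/

set_option linter.dupNamespace false

noncomputable section

open scoped Classical NumberField

namespace Summit.BirchSwinnertonDyer.BirchSwinnertonDyer.Theorems.KolyvaginDepthDoor

open Literature.NumberTheory.EllipticCurves Literature.NumberTheory.EllipticCurves.ModularForms
  WeierstrassCurve NumberField IsDedekindDomain
open Literature.NumberTheory.DiophantineGeometry (KodairaSymbol)
open Summit.BirchSwinnertonDyer.BirchSwinnertonDyer.Theorems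

/-! ## Supply conversion: structure + `Ш(E)[p] = 0` + twist condition ⟹ the signed clause -/

/-- **The signed rank clause from a FULL mod-`p` structure statement and the twist condition (no twist
pinning; route-free; UNCONDITIONAL).** `E/ℚ` elliptic globally minimal, `p` prime with `ρ̄_{E,p}` onto,
`K` a number field (`d_K ≠ 0`), level `N`. IF (`hstr`, W. Zhang's Lemma 8.4 (1) shape with BOTH halves
of the dichotomy) some frame, some `n ∈ Λ` and some datum have `c_1(n) ≠ 0` with
`#Sel_p(E) = p^{ν+1} ∧ #Sel_p(E^{(d_K)}) ≤ p^ν` or `#Sel_p(E^{(d_K)}) = p^{ν+1} ∧ #Sel_p(E) ≤ p^ν`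
(`ν = ν(n)`), IF `Ш(E/ℚ)[p] = 0`, and IF the twist condition `#Sel_p(E^{(d_K)}) ≤ p^{rank E} ∨
(Ш(E^{(d_K)})[p] = 0 ∧ rank E^{(d_K)} = rank E + 1)` holds, THEN that class satisfies
`ν+1 ≤ rank E ∨ (ν ≤ rank E ∧ ν+1 ≤ rank E^{(d_K)})`. Proof: `#Sel_p(E) = p^{rank E}` (AEC X.4.2,
`E[p]` irreducible); `E`-side ⟹ `rank E = ν+1`; twist side ⟹ `rank E ≤ ν`, so the first disjunct of
the twist condition contradicts `#Sel_p(E^{(d_K)}) = p^{ν+1}`, and the second gives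
`#Sel_p(E^{(d_K)}) = p^{rank E^{(d_K)}} = p^{ν+1}`, `ν = rank E`. No parity theorem.
[cite: WZhang2014, Lemma 8.4 (1) (p. 236)] [cite: SilvermanAEC2009, Thm. X.4.2] -/
theorem rankClause_of_structure_of_twistCondition
    (W : WeierstrassCurve ℚ) [W.IsElliptic] [W.IsGloballyMinimal] (p : ℕ) [hp : Fact p.Prime]
    (hsurj : W.HasSurjectiveModNGaloisRep p)
    (K : Type) [Field K] [NumberField K] {N : ℕ} [NeZero N]
    (hstr : ∃ (Dt : ModularParametrizationData W N) (β : ℤ) (ι : K →+* ℂ) (n : ℕ)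
      (d : KolyvaginHeegnerData Dt β ι n),
      KolyvaginDescent.KolSupp (Zhang2014.IsKolyvaginPrime N W K p) n ∧
        d.kolyvaginClass hp.out 1 ≠ 0 ∧
        ((Nat.card (W.selmerGroup p) = p ^ (n.primeFactors.card + 1) ∧
            Nat.card ((W.quadraticTwist (NumberField.discr K : ℚ)).selmerGroup p) ≤
              p ^ n.primeFactors.card) ∨
          (Nat.card ((W.quadraticTwist (NumberField.discr K : ℚ)).selmerGroup p) =
              p ^ (n.primeFactors.card + 1) ∧
            Nat.card (W.selmerGroup p) ≤ p ^ n.primeFactors.card)))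
    (hshaW : (W.sha ⊓ AddSubgroup.torsionBy W.galH1 (p : ℤ) : AddSubgroup W.galH1) = ⊥)
    (hTC : Nat.card ((W.quadraticTwist (NumberField.discr K : ℚ)).selmerGroup p) ≤
        p ^ W.mordellWeilRank ∨
      (((W.quadraticTwist (NumberField.discr K : ℚ)).sha ⊓
          AddSubgroup.torsionBy (W.quadraticTwist (NumberField.discr K : ℚ)).galH1 (p : ℤ) :
          AddSubgroup (W.quadraticTwist (NumberField.discr K : ℚ)).galH1) = ⊥ ∧
        (W.quadraticTwist (NumberField.discr K : ℚ)).mordellWeilRank = W.mordellWeilRank + 1)) :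
    ∃ (Dt : ModularParametrizationData W N) (β : ℤ) (ι : K →+* ℂ) (n : ℕ)
      (d : KolyvaginHeegnerData Dt β ι n),
      KolyvaginDescent.KolSupp (Zhang2014.IsKolyvaginPrime N W K p) n ∧
        d.kolyvaginClass hp.out 1 ≠ 0 ∧
        (n.primeFactors.card + 1 ≤ W.mordellWeilRank ∨
          (n.primeFactors.card ≤ W.mordellWeilRank ∧
            n.primeFactors.card + 1 ≤ (W.quadraticTwist (NumberField.discr K : ℚ)).mordellWeilRank)) := by
  obtain ⟨Dt, β, ι, n, d, hsupp, hne, hdich⟩ := hstr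
  have hpP : p.Prime := hp.out
  have h2p : 2 ≤ p := hpP.two_le
  have h1p : 1 < p := hpP.one_lt
  haveI : NeZero (p : ℚ) := ⟨by exact_mod_cast hpP.ne_zero⟩
  -- irreducibility of `E[p]` and of the twist's `E^{(d_K)}[p]`
  have hirr : W.HasIrreducibleModPGaloisRep p :=
    hasIrreducibleModPGaloisRep_of_hasSurjectiveModNGaloisRep W p hsurj
  have hdK : (NumberField.discr K : ℚ) ≠ 0 := by exact_mod_cast NumberField.discr_ne_zero K
  haveI := W.isElliptic_quadraticTwist hdK
  have hirrT : (W.quadraticTwist (NumberField.discr K : ℚ)).HasIrreducibleModPGaloisRep p :=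
    (W.hasIrreducibleModPGaloisRep_quadraticTwist_iff hdK p).mpr hirr
  -- the descent count on `E`
  have hSelW : Nat.card (W.selmerGroup p) = p ^ W.mordellWeilRank :=
    natCard_selmerGroup_eq_pow_rank_of_sha_inf_torsionBy_eq_bot W p hirr hshaW
  refine ⟨Dt, β, ι, n, d, hsupp, hne, ?_⟩
  rcases hdich with ⟨hW1, -⟩ | ⟨hT1, hWle⟩
  · -- the minimal class sits on the `E` side: `rank E = ν + 1`
    left
    rw [hSelW] at hW1
    have := Nat.pow_right_injective h2p hW1
    omega
  · -- it sits on the twist side: `rank E ≤ ν`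
    rw [hSelW] at hWle
    have hrle : W.mordellWeilRank ≤ n.primeFactors.card := (Nat.pow_le_pow_iff_right h1p).mp hWle
    rcases hTC with hle | ⟨hshaT, hr'⟩
    · -- `#Sel_p(E^{(d_K)}) = p^{ν+1} ≤ p^{rank E} ≤ p^ν`: impossible
      exfalso
      rw [hT1] at hle
      have := (Nat.pow_le_pow_iff_right h1p).mp hle
      omega
    · -- `Ш(E^{(d_K)})[p] = 0`, `rank E^{(d_K)} = rank E + 1 = ν + 1`
      right
      have hSelT : Nat.card ((W.quadraticTwist (NumberField.discr K : ℚ)).selmerGroup p) =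
          p ^ (W.quadraticTwist (NumberField.discr K : ℚ)).mordellWeilRank :=
        natCard_selmerGroup_eq_pow_rank_of_sha_inf_torsionBy_eq_bot _ p hirrT hshaT
      rw [hSelT] at hT1
      have := Nat.pow_right_injective h2p hT1
      constructor <;> omega

/-! ## Door: the crux body at `(E, p, K)` ⟹ `Ш(E)[p] = 0` and the (sharp) twist condition, (γ) only -/

/-- **DOOR OF THE CRUX BODY AT `(E, p, K)` ON THE KODAIRA–NÉRON CELL, with the twist condition
((γ) = `GrossLMS1991.prop37_2_frobeniusCongruence` only).** `E/ℚ` non-CM globally minimal, `K`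
imaginary quadratic Heegner with `d_K ≠ −3, −4`, `p ≥ 5` with `ρ_{E,p^n}` onto for all `n` and
`p ∤ ord_v(Δ_min)` at every multiplicative place. IF some frame, some square-free product `n₁` of
Kolyvagin primes and some datum have `c_1(n₁) ≠ 0` with the crux's signed clause
`ν+1 ≤ rank E ∨ (ν ≤ rank E ∧ ν+1 ≤ rank E^{(d_K)})`, THEN `Ш(E/ℚ)[p] = 0` and, SHARPLY: either
`1 ≤ rank E` and `#Sel_p(E^{(d_K)}/ℚ) ≤ p^{rank E − 1}` (first sign: Kolyvagin's second eigen-bound read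
on the twist), or `Ш(E^{(d_K)}/ℚ)[p] = 0` and `rank E^{(d_K)} = rank E + 1` (second sign). CONDITIONAL
on (γ) only; per curve; BSD is not proved by it. [cite: Kolyvagin1991MathAnn, Thm. 2.3]
[cite: GrossLMS1991, Prop. 3.7 (2), §5 (5.1), §10] [cite: SilvermanAEC2009, VII.6.1, X.4.2] -/
theorem shaTrivial_twistConditionSharp_of_kolyvaginClass_rankClause_kodairaNeron
    (h372 : GrossLMS1991.prop37_2_frobeniusCongruence)
    (W : WeierstrassCurve ℚ) [W.IsElliptic] [W.IsGloballyMinimal] (hcm : ¬ W.HasCM)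
    (p : ℕ) [hp : Fact p.Prime] (h5 : 5 ≤ p)
    (htower : ∀ n : ℕ, W.HasSurjectiveModNGaloisRep (p ^ n : ℕ))
    (hKN : ∀ v : HeightOneSpectrum (𝓞 ℚ), W.HasMultiplicativeReductionAt v →
      ¬ p ∣ W.ordMinimalDiscriminant v)
    (K : Type) [Field K] [NumberField K] (hK : IsImaginaryQuadratic K)
    (hD3 : NumberField.discr K ≠ -3) (hD4 : NumberField.discr K ≠ -4)
    [NeZero (W.conductorNorm ℤ)] (hH : SatisfiesHeegnerHypothesis (W.conductorNorm ℤ) K)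
    (h : ∃ (Dt : ModularParametrizationData W (W.conductorNorm ℤ)) (β : ℤ) (ι : K →+* ℂ) (n₁ : ℕ)
      (d : KolyvaginHeegnerData Dt β ι n₁), Squarefree n₁ ∧
        (∀ q ∈ n₁.primeFactors, Zhang2014.IsKolyvaginPrime (W.conductorNorm ℤ) W K p q) ∧
        d.kolyvaginClass hp.out 1 ≠ 0 ∧
        (n₁.primeFactors.card + 1 ≤ W.mordellWeilRank ∨
          (n₁.primeFactors.card ≤ W.mordellWeilRank ∧
            n₁.primeFactors.card + 1 ≤ (W.quadraticTwist (NumberField.discr K : ℚ)).mordellWeilRank))) :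
    (W.sha ⊓ AddSubgroup.torsionBy W.galH1 (p : ℤ) : AddSubgroup W.galH1) = ⊥ ∧
      ((1 ≤ W.mordellWeilRank ∧
          Nat.card ((W.quadraticTwist (NumberField.discr K : ℚ)).selmerGroup p) ≤
            p ^ (W.mordellWeilRank - 1)) ∨
        (((W.quadraticTwist (NumberField.discr K : ℚ)).sha ⊓
            AddSubgroup.torsionBy (W.quadraticTwist (NumberField.discr K : ℚ)).galH1 (p : ℤ) :
            AddSubgroup (W.quadraticTwist (NumberField.discr K : ℚ)).galH1) = ⊥ ∧
          (W.quadraticTwist (NumberField.discr K : ℚ)).mordellWeilRank = W.mordellWeilRank + 1)) := by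
  obtain ⟨Dt, β, ι, n₁, d, hn₁, hk₁, hne, hclause⟩ := h
  have hp2 : p ≠ 2 := by omega
  have hadd : ∀ v : HeightOneSpectrum (𝓞 ℚ), W.HasAdditiveReductionAt v → p ≠ 3 ∨
      (W.kodairaSymbolAt v ≠ KodairaSymbol.IV ∧ W.kodairaSymbolAt v ≠ KodairaSymbol.IVstar) :=
    fun _ _ ↦ Or.inl (by omega)
  obtain ⟨c, hc, hcc⟩ := exists_conj_of_isImaginaryQuadratic K hK
  rcases hclause with hrank | ⟨hrank, hrank'⟩
  · -- first sign: `Ш(E)[p] = 0`, `rank E = ν + 1`, `#Sel_p(E^{(d_K)}) ≤ p^ν`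
    obtain ⟨-, hr, -, -, hbot, -⟩ :=
      shaCorank_eq_zero_of_kolyvaginClass_ne_zero_of_rank_le_of_datum_kodairaNeron h372 hcm hK hD3 hD4
        hH p hp2 htower c hc hcc hKN hadd hn₁ hk₁ d hne hrank
    obtain ⟨-, hSelT, -⟩ :=
      natCard_selmerGroup_twist_le_of_kolyvaginClass_ne_zero_of_datum_kodairaNeron h372 hcm hK hD3 hD4
        hH p hp2 htower c hc hcc hKN hadd hn₁ hk₁ d hne hrank
    refine ⟨by simpa only [pow_one] using hbot, Or.inl ⟨by omega, ?_⟩⟩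
    have hν : W.mordellWeilRank - 1 = n₁.primeFactors.card := by omega
    rw [hν]
    rw [pow_one] at hSelT
    exact hSelT
  · -- second sign: `Ш(E)[p] = 0`, `rank E = ν`, `Ш(E^{(d_K)})[p] = 0`, `rank E^{(d_K)} = ν + 1`
    obtain ⟨-, hr, -, hr', -, hbot, -, hbotT, -⟩ :=
      shaCorank_eq_zero_of_kolyvaginClass_ne_zero_of_twist_rank_of_datum_kodairaNeron h372 hcm hK hD3
        hD4 hH p hp2 htower c hc hcc hKN hadd hn₁ hk₁ d hne hrank hrank'
    refine ⟨by simpa only [pow_one] using hbot, Or.inr ⟨by simpa only [pow_one] using hbotT, ?_⟩⟩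
    omega

/-- **Door, twist condition in the exact-reading currency** (the sharp first-sign bound
`#Sel_p(E^{(d_K)}) ≤ p^{rank E − 1}` weakened to `≤ p^{rank E}`). CONDITIONAL on (γ) only.
[cite: Kolyvagin1991MathAnn, Thm. 2.3] [cite: GrossLMS1991, Prop. 3.7 (2)] -/
theorem shaTrivial_twistCondition_of_kolyvaginClass_rankClause_kodairaNeron
    (h372 : GrossLMS1991.prop37_2_frobeniusCongruence)
    (W : WeierstrassCurve ℚ) [W.IsElliptic] [W.IsGloballyMinimal] (hcm : ¬ W.HasCM)
    (p : ℕ) [hp : Fact p.Prime] (h5 : 5 ≤ p)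
    (htower : ∀ n : ℕ, W.HasSurjectiveModNGaloisRep (p ^ n : ℕ))
    (hKN : ∀ v : HeightOneSpectrum (𝓞 ℚ), W.HasMultiplicativeReductionAt v →
      ¬ p ∣ W.ordMinimalDiscriminant v)
    (K : Type) [Field K] [NumberField K] (hK : IsImaginaryQuadratic K)
    (hD3 : NumberField.discr K ≠ -3) (hD4 : NumberField.discr K ≠ -4)
    [NeZero (W.conductorNorm ℤ)] (hH : SatisfiesHeegnerHypothesis (W.conductorNorm ℤ) K)
    (h : ∃ (Dt : ModularParametrizationData W (W.conductorNorm ℤ)) (β : ℤ) (ι : K →+* ℂ) (n₁ : ℕ)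
      (d : KolyvaginHeegnerData Dt β ι n₁), Squarefree n₁ ∧
        (∀ q ∈ n₁.primeFactors, Zhang2014.IsKolyvaginPrime (W.conductorNorm ℤ) W K p q) ∧
        d.kolyvaginClass hp.out 1 ≠ 0 ∧
        (n₁.primeFactors.card + 1 ≤ W.mordellWeilRank ∨
          (n₁.primeFactors.card ≤ W.mordellWeilRank ∧
            n₁.primeFactors.card + 1 ≤ (W.quadraticTwist (NumberField.discr K : ℚ)).mordellWeilRank))) :
    (W.sha ⊓ AddSubgroup.torsionBy W.galH1 (p : ℤ) : AddSubgroup W.galH1) = ⊥ ∧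
      (Nat.card ((W.quadraticTwist (NumberField.discr K : ℚ)).selmerGroup p) ≤ p ^ W.mordellWeilRank ∨
        (((W.quadraticTwist (NumberField.discr K : ℚ)).sha ⊓
            AddSubgroup.torsionBy (W.quadraticTwist (NumberField.discr K : ℚ)).galH1 (p : ℤ) :
            AddSubgroup (W.quadraticTwist (NumberField.discr K : ℚ)).galH1) = ⊥ ∧
          (W.quadraticTwist (NumberField.discr K : ℚ)).mordellWeilRank = W.mordellWeilRank + 1)) := by
  obtain ⟨hsha, hTC⟩ := shaTrivial_twistConditionSharp_of_kolyvaginClass_rankClause_kodairaNeron h372 W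
    hcm p h5 htower hKN K hK hD3 hD4 hH h
  refine ⟨hsha, ?_⟩
  rcases hTC with ⟨-, hle⟩ | h2
  · left
    exact hle.trans (Nat.pow_le_pow_right hp.out.pos (Nat.sub_le _ _))
  · exact Or.inr h2

/-! ## The full structure statement on the frame with `p ∤ c_φ` (five print facts; Néron scaling discharged) -/

/-- **The FULL mod-`p` structure statement on the Kodaira–Néron cell from FIVE print facts BY NAME
(Castella–Sano Thm. 3, Zanarella 2.18 (Selmer form), Howard–Zanarella rigidity, modularity, Mazur 1978
Cor. 4.1) — the Néron mapping property being the tree THEOREM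
`integral_neronScaling_of_isGloballyMinimal_holds`.** Same as g13's
`exists_kolyvaginClass_one_selmerCard_of_maninPrint` but keeping BOTH halves of W. Zhang's Lemma 8.4 (1)
dichotomy (`#Sel_p(E) = p^{ν+1} ∧ #Sel_p(E^{(d_K)}) ≤ p^ν`, or the mirror statement) and one print
hypothesis fewer. CONDITIONAL on the five named facts. [cite: CastellaSano2026, Thm. 3 (arXiv:2601.14504 §1.1.6)]
[cite: Zanarella2019, Prop. 2.18, Cor. 2.12, Cor. 2.14] [cite: Howard2004, Lemma 1.6.4] [cite: Mazur1978, Cor. 4.1]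
[cite: WZhang2014, Lemma 8.4 (1) (p. 236)] -/
theorem exists_kolyvaginClass_one_selmerCard_dichotomy_of_maninPrint
    (h3 : Literature.NumberTheory.EllipticCurves.CastellaSano2026_kolyvaginClass_selmerDivisibility_eq_padicValNat_tamagawaProduct)
    (hZ : Literature.NumberTheory.EllipticCurves.Zanarella2019_kolyvaginClass_one_ne_zero_of_not_selmerDivisible)
    (hHZ : Literature.NumberTheory.EllipticCurves.HowardZanarella_exists_minimal_kolyvaginClass_one_selmerCard_of_ne_zero)
    (hnf : exists_isNewformOf) (hMaz : mazur_not_dvd_maninConstant_of_odd)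
    (W : WeierstrassCurve ℚ) [W.IsElliptic] [W.IsGloballyMinimal] (p : ℕ) [hp : Fact p.Prime]
    (h5 : 5 ≤ p) (hgood : W.HasGoodReductionAtPrime p) (hord : ¬ (p : ℤ) ∣ W.frobeniusTrace p)
    (htower : ∀ n : ℕ, W.HasSurjectiveModNGaloisRep (p ^ n : ℕ))
    (hKN : ∀ v : HeightOneSpectrum (𝓞 ℚ), W.HasMultiplicativeReductionAt v →
      ¬ p ∣ W.ordMinimalDiscriminant v)
    (K : Type) [Field K] [NumberField K] (hK : IsImaginaryQuadratic K)
    [NeZero (W.conductorNorm ℤ)] (hHeeg : SatisfiesHeegnerHypothesis (W.conductorNorm ℤ) K)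
    (hodd : Odd (NumberField.discr K)) (hD3 : NumberField.discr K ≠ -3) (hD4 : NumberField.discr K ≠ -4)
    (hpD : ¬ ((p : ℤ) ∣ NumberField.discr K)) (hspl : SatisfiesHeegnerHypothesis p K) :
    ∃ (Dt : ModularParametrizationData W (W.conductorNorm ℤ)) (β : ℤ) (ι : K →+* ℂ) (n : ℕ)
      (d : KolyvaginHeegnerData Dt β ι n),
      KolyvaginDescent.KolSupp (Zhang2014.IsKolyvaginPrime (W.conductorNorm ℤ) W K p) n ∧
        d.kolyvaginClass hp.out 1 ≠ 0 ∧
        ((Nat.card (W.selmerGroup p) = p ^ (n.primeFactors.card + 1) ∧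
            Nat.card ((W.quadraticTwist (NumberField.discr K : ℚ)).selmerGroup p) ≤
              p ^ n.primeFactors.card) ∨
          (Nat.card ((W.quadraticTwist (NumberField.discr K : ℚ)).selmerGroup p) =
              p ^ (n.primeFactors.card + 1) ∧
            Nat.card (W.selmerGroup p) ≤ p ^ n.primeFactors.card)) := by
  have hpP : p.Prime := hp.out
  have hp2 : p ≠ 2 := by omega
  have hsur : W.HasSurjectiveModNGaloisRep p := by simpa only [pow_one] using htower 1
  -- `(d_K, N) = 1` from the Heegner hypothesis
  have hDN : IsCoprime (NumberField.discr K) ((W.conductorNorm ℤ : ℕ) : ℤ) := by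
    rw [Int.isCoprime_iff_gcd_eq_one, Int.gcd_comm]
    exact Literature.SatisfiesHeegnerHypothesis.coprime_discr hK.1 hHeeg
  -- the frame: a datum with `p ∤ c` (modularity + Mazur; Néron scaling is a theorem)
  have hpN : ¬ p ^ 2 ∣ W.conductorNorm ℤ := fun h ↦
    not_dvd_conductorNorm_of_hasGoodReductionAtPrime W hgood (dvd_trans (dvd_pow_self p two_ne_zero) h)
  have hirr : W.HasIrreducibleModPGaloisRep p :=
    hasIrreducibleModPGaloisRep_of_hasSurjectiveModNGaloisRep W p hsur
  obtain ⟨Dt, hc⟩ := Summit.BirchSwinnertonDyer.Rank1Residual.X11b.exists_modularParametrizationData_not_dvd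
    hnf hMaz integral_neronScaling_of_isGloballyMinimal_holds W rfl hpP hp2 hpN hirr
  obtain ⟨β, hβ⟩ := exists_dvd_sq_sub_discr_holds (W.conductorNorm ℤ) K hK hHeeg
  obtain ⟨ι⟩ : Nonempty (K →+* ℂ) := inferInstance
  haveI : ∀ k : ℕ, NumberField (ringClassField K ι k) := fun k ↦
    Summit.BirchSwinnertonDyer.Rank1Residual.JET.numberField_ringClassField K hK ι k
  -- `p ∤ Tam_E` on the Kodaira–Néron cell
  have htam : ¬ p ∣ W.tamagawaProduct := not_dvd_tamagawaProduct_of_kodairaNeron W p h5 hKN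
  obtain ⟨n, d, hsupp, hne, -, hdich⟩ :=
    exists_minimal_kolyvaginClass_one_selmerCard_of_castellaSano h3 hZ hHZ W p h5 hgood hord hsur htower
      htam K hK hHeeg hodd hD3 hD4 hDN hpD hspl Dt hc β hβ ι
  exact ⟨Dt, β, ι, n, d, hsupp, hne, hdich⟩

/-! ## The exact reading per `(E, p, K)` -/

/-- **THE EXACT READING OF THE KN CRUX BODY AT `(E, p, K)`, ALL RANKS, NO TWIST PINNING (modulo (γ)
and five print facts by name).** `E/ℚ` non-CM globally minimal; `p ≥ 5` good ordinary with
`ρ_{E,p^n}` onto for all `n` and `p ∤ ord_v(Δ_min)` at multiplicative places; `K` imaginary quadratic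
Heegner with `d_K` odd, `≠ −3, −4`, `p ∤ d_K`, `p` split in `K`. THEN
«∃ frame, square-free product `n₁` of Kolyvagin primes, datum: `c_1(n₁) ≠ 0` ∧
(`ν+1 ≤ rank E` ∨ (`ν ≤ rank E` ∧ `ν+1 ≤ rank E^{(d_K)}`))» `↔`
«`Ш(E/ℚ)[p] = 0` ∧ (`#Sel_p(E^{(d_K)}/ℚ) ≤ p^{rank E}` ∨ (`Ш(E^{(d_K)}/ℚ)[p] = 0` ∧
`rank E^{(d_K)} = rank E + 1`))». `→`: the doors ((γ) only); `←`: the full structure statement (five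
print facts) and `rankClause_of_structure_of_twistCondition`. The left side is the crux
`KolyvaginDepthSupplyKN`'s `∃`-body at this `(p, K)`; the right side is KatoTransfer's X1 at the torsion
level PLUS a condition on ONE Heegner twist's `p`-Selmer group. g13's rank-2 slice
(`kolyvaginClass_one_prime_ne_zero_iff_sha_trivial_of_rank_two_of_maninPrint`) is the case `rank E = 2`,
twist pinned. CONDITIONAL on the named facts; per curve; BSD is not proved by it.
[cite: GrossLMS1991, Prop. 3.7 (2)] [cite: CastellaSano2026, Thm. 3] [cite: Zanarella2019, Prop. 2.18, Cor. 2.14]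
[cite: Howard2004, Lemma 1.6.4] [cite: Mazur1978, Cor. 4.1] [cite: Kolyvagin1991MathAnn, Thm. 2.3]
[cite: SilvermanAEC2009, Thm. X.4.2] -/
theorem kolyvaginClass_rankClause_iff_shaTrivial_twistCondition_of_maninPrint
    (h372 : GrossLMS1991.prop37_2_frobeniusCongruence)
    (h3 : Literature.NumberTheory.EllipticCurves.CastellaSano2026_kolyvaginClass_selmerDivisibility_eq_padicValNat_tamagawaProduct)
    (hZ : Literature.NumberTheory.EllipticCurves.Zanarella2019_kolyvaginClass_one_ne_zero_of_not_selmerDivisible)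
    (hHZ : Literature.NumberTheory.EllipticCurves.HowardZanarella_exists_minimal_kolyvaginClass_one_selmerCard_of_ne_zero)
    (hnf : exists_isNewformOf) (hMaz : mazur_not_dvd_maninConstant_of_odd)
    (W : WeierstrassCurve ℚ) [W.IsElliptic] [W.IsGloballyMinimal] (hcm : ¬ W.HasCM)
    (p : ℕ) [hp : Fact p.Prime] (h5 : 5 ≤ p) (hgood : W.HasGoodReductionAtPrime p)
    (hord : ¬ (p : ℤ) ∣ W.frobeniusTrace p)
    (htower : ∀ n : ℕ, W.HasSurjectiveModNGaloisRep (p ^ n : ℕ))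
    (hKN : ∀ v : HeightOneSpectrum (𝓞 ℚ), W.HasMultiplicativeReductionAt v →
      ¬ p ∣ W.ordMinimalDiscriminant v)
    (K : Type) [Field K] [NumberField K] (hK : IsImaginaryQuadratic K)
    (hodd : Odd (NumberField.discr K)) (hD3 : NumberField.discr K ≠ -3) (hD4 : NumberField.discr K ≠ -4)
    (hpD : ¬ ((p : ℤ) ∣ NumberField.discr K)) (hspl : SatisfiesHeegnerHypothesis p K)
    [NeZero (W.conductorNorm ℤ)] (hH : SatisfiesHeegnerHypothesis (W.conductorNorm ℤ) K) :
    (∃ (Dt : ModularParametrizationData W (W.conductorNorm ℤ)) (β : ℤ) (ι : K →+* ℂ) (n₁ : ℕ)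
      (d : KolyvaginHeegnerData Dt β ι n₁), Squarefree n₁ ∧
        (∀ q ∈ n₁.primeFactors, Zhang2014.IsKolyvaginPrime (W.conductorNorm ℤ) W K p q) ∧
        d.kolyvaginClass hp.out 1 ≠ 0 ∧
        (n₁.primeFactors.card + 1 ≤ W.mordellWeilRank ∨
          (n₁.primeFactors.card ≤ W.mordellWeilRank ∧
            n₁.primeFactors.card + 1 ≤ (W.quadraticTwist (NumberField.discr K : ℚ)).mordellWeilRank))) ↔
    ((W.sha ⊓ AddSubgroup.torsionBy W.galH1 (p : ℤ) : AddSubgroup W.galH1) = ⊥ ∧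
      (Nat.card ((W.quadraticTwist (NumberField.discr K : ℚ)).selmerGroup p) ≤ p ^ W.mordellWeilRank ∨
        (((W.quadraticTwist (NumberField.discr K : ℚ)).sha ⊓
            AddSubgroup.torsionBy (W.quadraticTwist (NumberField.discr K : ℚ)).galH1 (p : ℤ) :
            AddSubgroup (W.quadraticTwist (NumberField.discr K : ℚ)).galH1) = ⊥ ∧
          (W.quadraticTwist (NumberField.discr K : ℚ)).mordellWeilRank = W.mordellWeilRank + 1))) := by
  constructor
  · exact shaTrivial_twistCondition_of_kolyvaginClass_rankClause_kodairaNeron h372 W hcm p h5 htower hKN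
      K hK hD3 hD4 hH
  · rintro ⟨hshaW, hTC⟩
    have hsur : W.HasSurjectiveModNGaloisRep p := by simpa only [pow_one] using htower 1
    have hstr := exists_kolyvaginClass_one_selmerCard_dichotomy_of_maninPrint h3 hZ hHZ hnf hMaz W p h5
      hgood hord htower hKN K hK hH hodd hD3 hD4 hpD hspl
    obtain ⟨Dt, β, ι, n, d, hsupp, hne, hclause⟩ :=
      rankClause_of_structure_of_twistCondition W p hsur K hstr hshaW hTC
    exact ⟨Dt, β, ι, n, d, hsupp.1, hsupp.2, hne, hclause⟩

end Summit.BirchSwinnertonDyer.BirchSwinnertonDyer.Theorems.KolyvaginDepthDoor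

end
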